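import Literature.Analysis.Complex.CauchyPompeiu
import Mathlib.Analysis.Calculus.FDeriv.Symmetric
import Mathlib.Analysis.Calculus.ContDiff.Basic
import HarnessLib

/-!
# Calculus of the directional Cauchy–Riemann operators `∂̄_v`

Elementary rules for `Literature.Analysis.Complex.dbarAlong v u x = ½ (Du(x)[v] + i Du(x)[iv])`
(`Literature/Analysis/Complex/CauchyPompeiu.lean`), the operators `∂/∂z̄_k` of Hörmander (1973),
§2.1, written coordinate-free, as used in the proof of the `∂̄`-Poincaré lemma on polydiscs
(Hörmander, Thm. 2.3.3):

* locality (`dbarAlong_congr_of_eventuallyEq`, `dbarAlong_eq_zero_of_eventuallyEq_zero`) and the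
  vanishing of `∂̄_v u (x)` when `u` is locally invariant under `x ↦ x + τ • v`
  (`dbarAlong_eq_zero_of_eventually_eq`);
* the Leibniz rule `∂̄_v (χ • f) = (∂̄_v χ) • f + χ • ∂̄_v f` (`dbarAlong_smul`) and
  `∂̄_v (u - w) = ∂̄_v u - ∂̄_v w` (`dbarAlong_sub`);
* smoothness: `u ∈ Cⁿ⁺¹ ⇒ ∂̄_v u ∈ Cⁿ`, `u ∈ C^∞ ⇒ ∂̄_v u ∈ C^∞` (`contDiff_dbarAlong`,
  `contDiff_infty_dbarAlong`);
* **commutation** `∂̄_v ∂̄_w u = ∂̄_w ∂̄_v u` for `u` of class `C²` (`dbarAlong_comm`, from the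
  symmetry of the second derivative, Mathlib's `ContDiffAt.isSymmSndFDerivAt`) — the identity
  `∂²/∂z̄_j∂z̄_k = ∂²/∂z̄_k∂z̄_j` behind `∂̄² = 0`;
* gluing: `χ • f` is globally `Cⁿ` when `χ ∈ Cⁿ` has `tsupport χ ⊆ D`, `D` open, and `f` is `Cⁿ`
  on `D` only (`contDiff_smul_of_tsupport_subset`) — the extension by zero of `ψ g` in Hörmander's
  proof of Thm. 2.3.3.

## References

* L. Hörmander, *An Introduction to Complex Analysis in Several Variables*, 2nd ed. (1973),
  §2.1 and the proof of Thm. 2.3.3. [HormanderSCV1973]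
-/

noncomputable section

open Set Filter Function Complex
open scoped Topology ContDiff

namespace Literature.Analysis.Complex

variable {E : Type*} [NormedAddCommGroup E] [NormedSpace ℂ E]
  {F : Type*} [NormedAddCommGroup F] [NormedSpace ℂ F]

/-! ### Locality -/

/-- `∂̄_v` is local: it only depends on the germ of the function. [folklore] -/
theorem dbarAlong_congr_of_eventuallyEq {u w : E → F} {x : E} (h : u =ᶠ[𝓝 x] w) (v : E) :
    dbarAlong v u x = dbarAlong v w x := by
  rw [dbarAlong_apply, dbarAlong_apply, h.fderiv_eq]

/-- A function vanishing near `x` has `∂̄_v = 0` at `x`. [folklore] -/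
theorem dbarAlong_eq_zero_of_eventuallyEq_zero {u : E → F} {x : E} (h : u =ᶠ[𝓝 x] 0) (v : E) :
    dbarAlong v u x = 0 := by
  rw [dbarAlong_congr_of_eventuallyEq h, dbarAlong_zero]

section RealDirectional

variable {E' : Type*} [NormedAddCommGroup E'] [NormedSpace ℝ E']
  {F' : Type*} [NormedAddCommGroup F'] [NormedSpace ℝ F']

/-- A directional derivative `Df(x)[w]` vanishes as soon as `f` is constant along the real line
`t ↦ x + t • w` near `t = 0`. [folklore] -/
theorem fderiv_apply_eq_zero_of_eventually_eq {f : E' → F'} {x w : E'}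
    (h : ∀ᶠ t : ℝ in 𝓝 0, f (x + t • w) = f x) : fderiv ℝ f x w = 0 := by
  by_cases hf : DifferentiableAt ℝ f x
  · have hl : HasDerivAt (fun t : ℝ => x + t • w) w 0 := by
      simpa using ((hasDerivAt_id (0 : ℝ)).smul_const w).const_add x
    have h1 : HasDerivAt (fun t : ℝ => f (x + t • w)) (fderiv ℝ f x w) 0 :=
      hf.hasFDerivAt.comp_hasDerivAt_of_eq 0 hl (by simp)
    have h2 : HasDerivAt (fun t : ℝ => f (x + t • w)) 0 0 :=
      (hasDerivAt_const (0 : ℝ) (f x)).congr_of_eventuallyEq h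
    exact h1.unique h2
  · rw [fderiv_zero_of_not_differentiableAt hf, zero_apply]

end RealDirectional

/-- **`∂̄_v u (x) = 0` when `u` is invariant under `x ↦ x + τ • v` for small `τ ∈ ℂ`** (e.g. a
cut-off not depending on the coordinate `z_k` near `x` has `∂/∂z̄_k = 0` there). [folklore] -/
theorem dbarAlong_eq_zero_of_eventually_eq {u : E → F} {x v : E}
    (h : ∀ᶠ τ : ℂ in 𝓝 0, u (x + τ • v) = u x) : dbarAlong v u x = 0 := by
  have h1 : ∀ᶠ t : ℝ in 𝓝 0, u (x + t • v) = u x := by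
    have ht : Tendsto (fun t : ℝ => (t : ℂ)) (𝓝 0) (𝓝 0) :=
      continuous_ofReal.tendsto' 0 0 (by simp)
    filter_upwards [ht.eventually h] with t ht'
    rwa [coe_smul] at ht'
  have h2 : ∀ᶠ t : ℝ in 𝓝 0, u (x + t • (I • v)) = u x := by
    have ht : Tendsto (fun t : ℝ => (t : ℂ) * I) (𝓝 0) (𝓝 0) :=
      (continuous_ofReal.mul continuous_const).tendsto' 0 0 (by simp)
    filter_upwards [ht.eventually h] with t ht'
    rwa [mul_smul, coe_smul] at ht'
  rw [dbarAlong_apply, fderiv_apply_eq_zero_of_eventually_eq h1,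
    fderiv_apply_eq_zero_of_eventually_eq h2, smul_zero, add_zero, smul_zero]

/-! ### Algebra -/

/-- `∂̄_v (-u) = -∂̄_v u`. [folklore] -/
theorem dbarAlong_neg (u : E → F) (v x : E) : dbarAlong v (fun y => -u y) x = -dbarAlong v u x := by
  simp only [dbarAlong_apply, fderiv_fun_neg, neg_apply]
  module

/-- `∂̄_v (u - w) = ∂̄_v u - ∂̄_v w` at points of differentiability. [folklore] -/
theorem dbarAlong_sub {u w : E → F} {x : E} (hu : DifferentiableAt ℝ u x)
    (hw : DifferentiableAt ℝ w x) (v : E) :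
    dbarAlong v (fun y => u y - w y) x = dbarAlong v u x - dbarAlong v w x := by
  simp only [dbarAlong_apply, fderiv_fun_sub hu hw, sub_apply]
  module

/-- **Leibniz rule** for `∂̄_v`: `∂̄_v (χ • f) = (∂̄_v χ) • f + χ • ∂̄_v f` for a scalar `χ` and a
vector-valued `f`, both real-differentiable at `x` (Hörmander (1973), §1.1: the product rule for
`∂/∂z̄`). [cite: HormanderSCV1973, §1.1] -/
theorem dbarAlong_smul {χ : E → ℂ} {f : E → F} {x : E} (hχ : DifferentiableAt ℝ χ x)
    (hf : DifferentiableAt ℝ f x) (v : E) :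
    dbarAlong v (fun y => χ y • f y) x = dbarAlong v χ x • f x + χ x • dbarAlong v f x := by
  simp only [dbarAlong_apply, fderiv_fun_smul hχ hf, add_apply, smul_apply,
    ContinuousLinearMap.smulRight_apply]
  module

/-! ### Smoothness of `∂̄_v u` -/

/-- If `u ∈ Cⁿ⁺¹` then `∂̄_v u ∈ Cⁿ`. [folklore] -/
theorem contDiff_dbarAlong {u : E → F} {n : WithTop ℕ∞} (hu : ContDiff ℝ (n + 1) u) (v : E) :
    ContDiff ℝ n (dbarAlong v u) := by
  have h := hu.fderiv_right (m := n) le_rfl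
  unfold dbarAlong
  exact contDiff_const.smul ((h.clm_apply contDiff_const).add
    (contDiff_const.smul (h.clm_apply contDiff_const)))

/-- If `u ∈ C^∞` then `∂̄_v u ∈ C^∞`. [folklore] -/
theorem contDiff_infty_dbarAlong {u : E → F} (hu : ContDiff ℝ ∞ u) (v : E) :
    ContDiff ℝ ∞ (dbarAlong v u) := by
  have h := (contDiff_infty_iff_fderiv.1 hu).2
  unfold dbarAlong
  exact contDiff_const.smul ((h.clm_apply contDiff_const).add
    (contDiff_const.smul (h.clm_apply contDiff_const)))

/-- `∂̄_v u` is continuous for `u ∈ C¹`. [folklore] -/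
theorem continuous_dbarAlong {u : E → F} (hu : ContDiff ℝ 1 u) (v : E) :
    Continuous (dbarAlong v u) := by
  have h := hu.continuous_fderiv one_ne_zero
  unfold dbarAlong
  exact continuous_const.smul ((h.clm_apply continuous_const).add
    (continuous_const.smul (h.clm_apply continuous_const)))

/-- `∂̄_v u` has compact support if `u` has. [folklore] -/
theorem hasCompactSupport_dbarAlong {u : E → F} (hu : HasCompactSupport u) (v : E) :
    HasCompactSupport (dbarAlong v u) := by
  refine (hu.fderiv (𝕜 := ℝ)).mono fun x hx => ?_
  contrapose! hx
  simp only [mem_support, ne_eq, not_not] at hx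
  simp [dbarAlong_apply, hx]

/-! ### Commutation of `∂̄_v` and `∂̄_w` -/

/-- The derivative of `∂̄_w u` in terms of the second derivative of `u`:
`D(∂̄_w u)(x)[v] = ½ (D²u(x)[v][w] + i D²u(x)[v][iw])`. [folklore] -/
theorem fderiv_dbarAlong_apply {u : E → F} {x : E} {n : WithTop ℕ∞} (hu : ContDiffAt ℝ n u x)
    (hn : 2 ≤ n) (v w : E) :
    fderiv ℝ (dbarAlong w u) x v = (2 : ℂ)⁻¹ • (fderiv ℝ (fderiv ℝ u) x v w +
      I • fderiv ℝ (fderiv ℝ u) x v (I • w)) := by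
  have hd : DifferentiableAt ℝ (fderiv ℝ u) x :=
    (hu.fderiv_right (m := 1) (by simpa [one_add_one_eq_two] using hn)).differentiableAt
      one_ne_zero
  have h1 : ∀ w' : E, HasFDerivAt (fun y => fderiv ℝ u y w')
      ((fderiv ℝ (fderiv ℝ u) x).flip w') x := fun w' => by
    simpa using hd.hasFDerivAt.clm_apply (hasFDerivAt_const w' x)
  have h2 : HasFDerivAt (dbarAlong w u) ((2 : ℂ)⁻¹ • ((fderiv ℝ (fderiv ℝ u) x).flip w +
      I • (fderiv ℝ (fderiv ℝ u) x).flip (I • w))) x := by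
    unfold dbarAlong
    exact ((h1 w).add ((h1 (I • w)).const_smul I)).const_smul (2 : ℂ)⁻¹
  rw [h2.fderiv]
  simp

/-- **`∂̄_v` and `∂̄_w` commute on `C²` functions**: `∂̄_v (∂̄_w u)(x) = ∂̄_w (∂̄_v u)(x)`
(Hörmander (1973), §2.1: `∂²u/∂z̄_j∂z̄_k = ∂²u/∂z̄_k∂z̄_j`, the computation giving `∂̄ ∂̄ = 0`),
from the symmetry of `D²u(x)`. [cite: HormanderSCV1973, §2.1] -/
theorem dbarAlong_comm {u : E → F} {x : E} {n : WithTop ℕ∞} (hu : ContDiffAt ℝ n u x)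
    (hn : 2 ≤ n) (v w : E) :
    dbarAlong v (dbarAlong w u) x = dbarAlong w (dbarAlong v u) x := by
  have hs : IsSymmSndFDerivAt ℝ u x := hu.isSymmSndFDerivAt (by simpa using hn)
  rw [dbarAlong_apply, dbarAlong_apply, fderiv_dbarAlong_apply hu hn,
    fderiv_dbarAlong_apply hu hn, fderiv_dbarAlong_apply hu hn, fderiv_dbarAlong_apply hu hn,
    hs w v, hs w (I • v), hs (I • w) v, hs (I • w) (I • v)]
  module

/-! ### Gluing a local function with a cut-off -/

section Glue

variable {E' : Type*} [NormedAddCommGroup E'] [NormedSpace ℝ E']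

/-- **Extension by zero of `χ • f`**: if `χ ∈ Cⁿ` has `tsupport χ ⊆ D` with `D` open and `f` is
`Cⁿ` on `D`, then `x ↦ χ x • f x` is `Cⁿ` on the whole space (it is `χ • f` on `D` and `0` near
every point outside `D`). This is how `ψ g ∈ C_0^∞` is formed in Hörmander's proof of Thm. 2.3.3.
[folklore] -/
theorem contDiff_smul_of_tsupport_subset {χ : E' → ℂ} {f : E' → F} {D : Set E'} {n : WithTop ℕ∞}
    (hD : IsOpen D) (hχ : ContDiff ℝ n χ) (hsub : tsupport χ ⊆ D) (hf : ContDiffOn ℝ n f D) :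
    ContDiff ℝ n fun x => χ x • f x := by
  refine contDiff_iff_contDiffAt.2 fun x => ?_
  by_cases hx : x ∈ D
  · exact hχ.contDiffAt.smul (hf.contDiffAt (hD.mem_nhds hx))
  · have h0 : (fun y => χ y • f y) =ᶠ[𝓝 x] fun _ => 0 := by
      filter_upwards [(notMem_tsupport_iff_eventuallyEq.1 fun h => hx (hsub h))] with y hy
      simp [hy]
    exact contDiffAt_const.congr_of_eventuallyEq h0

end Glue

end Literature.Analysis.Complex
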